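import Summits.Ventures.YMGap.RobustBall.FreeEnergyStrongConvexity
import Summits.Ventures.YMGap.Thresholds.PlaquetteMonotone
import HarnessLib

/-!
# Robust ball (Y2), strong-coupling laws — POSITIVE SPECIFIC-HEAT FLOOR and STRICTLY increasing mean plaquette

HONEST FRAMING: venture file of the cell `pub-ymgap` (QuantumFields programme), track ROBUST-BALL, seat rb-p2 (g8).  LATTICE statements
about the infinite-volume free energy density `f = freeEnergyDensity d ρ` of Wilson's `SU(N)` lattice gauge theory (tree coupling) and,
on the strong-coupling windows where the cell's C-PRESS theorems (seat ds-1: `PressureRegularity.*`) identify `f'` with the mean plaquette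
and `f''` with the plaquette susceptibility of THE DLR state, about that state.  «Specific heat» means the lattice quantity `f''` /
`Σ_{i<j} 4 Σ_q Cov(W_{p_ij}, W_q)`; the floors are one-link artefacts.  Nothing here is about the continuum, critical behaviour or Clay.

WHAT IS PROVED (consequences of `strongConvexOn_freeEnergyDensity`, modulus `m(b) = (1/2) e^{−8(d−1)Nb} V₀` on `[−b, b]`):
* every `N ≥ 2`, `d ≥ 2` (`mul_sub_le_deriv_sub_deriv`): at any two differentiability points `x < y` of `f` in `[−b, b]`,
  `f'(y) − f'(x) ≥ m(b)(y − x)` — the internal energy is STRICTLY monotone with a rate; (`le_of_hasDerivAt_deriv`) wherever `f` is twice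
  differentiable inside `(−b, b)`, `f'' ≥ m(b)`;
* `SU(2)`, `d = 4`, ds-1's one-state window `0 < β < 9/50` (tree coupling; Wilson `β_W = 2β < 9/25`):
  ★★ `su2_deriv_deriv_freeEnergyDensity_ge`: `f''(β) ≥ e^{−48β}/2`; ★★ `su2_susceptibility_ge`: the plaquette susceptibility of every
  (the) DLR state `Σ_{i<j} 4 Σ_q Cov_ν(W_{p_ij}, W_q) ≥ e^{−48β}/2 > 0` (ds-1's `su2_susceptibility_nonneg` had `≥ 0`);
  ★★ `su2_plaquette_increment_ge` / `su2_plaquette_strictMonoOn`: the mean plaquette `u = ⟨½ Re tr U_p⟩` is STRICTLY increasing in the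
  coupling, `u(β₂) − u(β₁) ≥ (e^{−48β₂}/24)(β₂ − β₁)` for `0 < β₁ < β₂ < 9/50` (ds-1's `su2_plaquette_monotoneOn` had non-strict);
* every `SU(N)`, `d ≥ 2`, 't Hooft window `0 < b < N/(12(d−1))`: `plaquette_increment_ge_dim_thooft` (strict monotonicity with rate).

References: S. Friedli, Y. Velenik (2017) §3.2; B. Simon, *The Statistical Mechanics of Lattice Gases* I (1993) §II.1 (fluctuation–response).
Everything here is proved; no definition, no named fact. [folklore]
-/

noncomputable section

open MeasureTheory ProbabilityTheory Finset Function Filter Topology Set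
open Literature.MathematicalPhysics.QuantumLattice Literature.MathematicalPhysics.QuantumFieldTheory
open Summit.Ventures.YMGap.PressureRegularity

namespace Summit.Ventures.YMGap.RobustBall

namespace EnergyVariance

/-! ### Part A — every `N`, every `d`: strict monotonicity of `f'` with a rate; the second-derivative floor -/

section General

variable {d N : ℕ} {G : Type*} [Group G] [TopologicalSpace G] [IsTopologicalGroup G] [CompactSpace G]
  [MeasurableSpace G] [BorelSpace G] [SecondCountableTopology G] (ρ : G →* Matrix (Fin N) (Fin N) ℂ)

/-- ★ **The internal energy is strictly monotone with a rate.**  `G ≅ SU(N)` (`N ≥ 2`), `d ≥ 2`: at any two differentiability points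
`x < y` of the free energy density in `[−b, b]`,
`f'(y) − f'(x) ≥ (1/2) e^{−8(d−1)Nb} V₀ · (y − x)`. [folklore] -/
theorem mul_sub_le_deriv_sub_deriv (hρ : IsSpecialUnitaryModel ρ) (hN : 2 ≤ N) (hd : 2 ≤ d) {b x y : ℝ}
    (hx : x ∈ Set.Icc (-b) b) (hy : y ∈ Set.Icc (-b) b) (hxy : x < y)
    (hfx : DifferentiableAt ℝ (freeEnergyDensity d ρ) x) (hfy : DifferentiableAt ℝ (freeEnergyDensity d ρ) y) :
    (1 / 2 : ℝ) * Real.exp (-(8 * (d - 1 : ℕ) * N * b)) * PlaquetteLowerBound.charVariance ρ * (y - x) ≤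
      deriv (freeEnergyDensity d ρ) y - deriv (freeEnergyDensity d ρ) x := by
  set m : ℝ := (1 / 2 : ℝ) * Real.exp (-(8 * (d - 1 : ℕ) * N * b)) * PlaquetteLowerBound.charVariance ρ with hm
  have hconv := strongConvexOn_real_iff.1 (strongConvexOn_freeEnergyDensity ρ hρ hN hd b)
  have hgx : HasDerivAt (fun t => freeEnergyDensity d ρ t - m / 2 * t ^ 2) (deriv (freeEnergyDensity d ρ) x - m * x) x :=
    hfx.hasDerivAt.fun_sub (hasDerivAt_half_mul_sq m x)
  have hgy : HasDerivAt (fun t => freeEnergyDensity d ρ t - m / 2 * t ^ 2) (deriv (freeEnergyDensity d ρ) y - m * y) y :=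
    hfy.hasDerivAt.fun_sub (hasDerivAt_half_mul_sq m y)
  have h1 := hconv.le_slope_of_hasDerivAt hx hy hxy hgx
  have h2 := hconv.slope_le_of_hasDerivAt hx hy hxy hgy
  have h := h1.trans h2
  nlinarith [h, hxy]

/-- ★ **The second-derivative floor.**  If `f` is differentiable near `x ∈ (−b, b)` and `f'` is differentiable at `x` with derivative `f''`,
then `f'' ≥ (1/2) e^{−8(d−1)Nb} V₀`. [folklore] -/
theorem le_of_hasDerivAt_deriv (hρ : IsSpecialUnitaryModel ρ) (hN : 2 ≤ N) (hd : 2 ≤ d) {b x f'' : ℝ}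
    (hx : x ∈ Set.Ioo (-b) b) (hdiff : ∀ᶠ y in 𝓝 x, DifferentiableAt ℝ (freeEnergyDensity d ρ) y)
    (h2 : HasDerivAt (deriv (freeEnergyDensity d ρ)) f'' x) :
    (1 / 2 : ℝ) * Real.exp (-(8 * (d - 1 : ℕ) * N * b)) * PlaquetteLowerBound.charVariance ρ ≤ f'' := by
  have hsub : Set.Ioi x ⊆ {x}ᶜ := fun y hy => Set.mem_compl_singleton_iff.2 (ne_of_gt hy)
  have ht : Tendsto (slope (deriv (freeEnergyDensity d ρ)) x) (𝓝[>] x) (𝓝 f'') :=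
    h2.tendsto_slope.mono_left (nhdsWithin_mono x hsub)
  refine ge_of_tendsto ht ?_
  have hd1 : ∀ᶠ y in 𝓝[>] x, DifferentiableAt ℝ (freeEnergyDensity d ρ) y := nhdsWithin_le_nhds hdiff
  have hd2 : ∀ᶠ y in 𝓝[>] x, y ∈ Set.Icc (-b) b :=
    nhdsWithin_le_nhds (Filter.mem_of_superset (Ioo_mem_nhds hx.1 hx.2) Set.Ioo_subset_Icc_self)
  have hd3 : ∀ᶠ y in 𝓝[>] x, y ∈ Set.Ioi x := eventually_mem_nhdsWithin
  filter_upwards [hd1, hd2, hd3] with y hy1 hy2 hy3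
  rw [Set.mem_Ioi] at hy3
  rw [slope_def_field, le_div_iff₀ (sub_pos.2 hy3)]
  exact mul_sub_le_deriv_sub_deriv ρ hρ hN hd (Set.Ioo_subset_Icc_self hx) hy2 hy3 hdiff.self_of_nhds hy1

end General

/-! ### Part B — `SU(2)`, `d = 4`: the specific-heat floor and the strictly increasing mean plaquette on the one-state window -/

section SU2

/-- ★★ **THE SPECIFIC-HEAT FLOOR, `SU(2)`, `d = 4`**: at every `0 < β < 9/50` (tree coupling), `f''(β) ≥ e^{−48β}/2`. [folklore] -/
theorem su2_deriv_deriv_freeEnergyDensity_ge {β : ℝ} (hβ : β ∈ Set.Ioo (0 : ℝ) (9 / 50)) :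
    Real.exp (-(48 * β)) / 2 ≤ deriv (deriv (freeEnergyDensity 4 (fundamentalRep (Fin 2)))) β := by
  have hρ := TorusAreaLaw.isSpecialUnitaryModel_fundamentalRep 2
  obtain ⟨ν, hν⟩ := ymGibbsMeasures_nonempty (d := 4) (fundamentalRep (Fin 2)) (continuous_fundamentalRep (Fin 2)) β
  have h2 := su2_hasDerivAt_deriv_freeEnergyDensity_of_mem hβ hν
  have hval := h2.deriv
  have hdiff : ∀ᶠ y in 𝓝 β, DifferentiableAt ℝ (freeEnergyDensity 4 (fundamentalRep (Fin 2))) y := by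
    filter_upwards [Ioo_mem_nhds hβ.1 hβ.2] with y hy
    exact (su2_differentiableOn_freeEnergyDensity y hy).differentiableAt (Ioo_mem_nhds hy.1 hy.2)
  -- for every `b > β`: `m(b) ≤ f''(β)`
  have key : ∀ b : ℝ, β < b → Real.exp (-(48 * b)) / 2 ≤ deriv (deriv (freeEnergyDensity 4 (fundamentalRep (Fin 2)))) β := by
    intro b hb
    have h := le_of_hasDerivAt_deriv (d := 4) (fundamentalRep (Fin 2)) hρ le_rfl (by norm_num) (b := b) (x := β)
      ⟨by linarith [hβ.1], hb⟩ hdiff (hval ▸ h2)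
    rw [HaarSecondMoments.charVariance_su2] at h
    have e : (1 / 2 : ℝ) * Real.exp (-(8 * (4 - 1 : ℕ) * (2 : ℕ) * b)) * 1 = Real.exp (-(48 * b)) / 2 := by
      norm_num; ring_nf
    rw [e] at h
    exact h
  -- `b ↓ β`
  have hcont : Tendsto (fun b : ℝ => Real.exp (-(48 * b)) / 2) (𝓝[>] β) (𝓝 (Real.exp (-(48 * β)) / 2)) := by
    have hc : Continuous fun b : ℝ => Real.exp (-(48 * b)) / 2 := by fun_prop
    exact (hc.tendsto β).mono_left nhdsWithin_le_nhds
  exact le_of_tendsto hcont (eventually_mem_nhdsWithin.mono key)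

/-- ★★ **THE PLAQUETTE SUSCEPTIBILITY IS STRICTLY POSITIVE WITH AN EXPLICIT FLOOR** (`SU(2)`, `d = 4`, `0 < β < 9/50`): for every (the)
DLR state `ν ∈ 𝒢(β)`, `Σ_{i<j} 4 Σ_q Cov_ν(W_{(0;ij)}, W_q) ≥ e^{−48β}/2` (`W = ½ Re tr`; ds-1's second thermodynamic identity
`su2_deriv_deriv_freeEnergyDensity_eq`). [folklore] -/
theorem su2_susceptibility_ge {β : ℝ} (hβ : β ∈ Set.Ioo (0 : ℝ) (9 / 50))
    {ν : Measure (LGConfig 4 (Matrix.specialUnitaryGroup (Fin 2) ℂ))}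
    (hν : ν ∈ ymGibbsMeasures (d := 4) (fundamentalRep (Fin 2)) β) :
    Real.exp (-(48 * β)) / 2 ≤
      ∑ q : {q : Fin 4 × Fin 4 // q.1 < q.2}, 4 * ∑' r : ZdPlaquette 4,
        cov[zdPlaquetteObs (fundamentalRep (Fin 2)) 0 q.1.1 q.1.2, zdPlaquetteObs (fundamentalRep (Fin 2)) r.1 r.2.1.1 r.2.1.2; ν] := by
  rw [← su2_deriv_deriv_freeEnergyDensity_eq hβ hν]
  exact su2_deriv_deriv_freeEnergyDensity_ge hβ

/-- ★★ **THE MEAN PLAQUETTE IS STRICTLY INCREASING IN THE COUPLING, WITH A RATE** (`SU(2)`, `d = 4`): for `0 < β₁ < β₂ < 9/50` (tree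
coupling) and DLR states `ν₁ ∈ 𝒢(β₁)`, `ν₂ ∈ 𝒢(β₂)`,
`u(ν₂) − u(ν₁) ≥ (e^{−48β₂}/24)(β₂ − β₁)`, `u = ⟨½ Re tr U_{(0;01)}⟩`. [folklore] -/
theorem su2_plaquette_increment_ge {β₁ β₂ : ℝ} (h1 : 0 < β₁) (h12 : β₁ < β₂) (h2 : β₂ < 9 / 50)
    {ν₁ ν₂ : Measure (LGConfig 4 (Matrix.specialUnitaryGroup (Fin 2) ℂ))}
    (hν₁ : ν₁ ∈ ymGibbsMeasures (d := 4) (fundamentalRep (Fin 2)) β₁)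
    (hν₂ : ν₂ ∈ ymGibbsMeasures (d := 4) (fundamentalRep (Fin 2)) β₂) :
    Real.exp (-(48 * β₂)) / 24 * (β₂ - β₁) ≤
      (∫ U, zdPlaquetteObs (fundamentalRep (Fin 2)) 0 0 1 U ∂ν₂) - ∫ U, zdPlaquetteObs (fundamentalRep (Fin 2)) 0 0 1 U ∂ν₁ := by
  have hρ := TorusAreaLaw.isSpecialUnitaryModel_fundamentalRep 2
  have hb1 : β₁ ∈ Set.Ioo (0 : ℝ) (9 / 50) := ⟨h1, by linarith⟩
  have hb2 : β₂ ∈ Set.Ioo (0 : ℝ) (9 / 50) := ⟨by linarith, h2⟩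
  have hd1 := su2_deriv_freeEnergyDensity_eq_plaquette hb1 hν₁
  have hd2 := su2_deriv_freeEnergyDensity_eq_plaquette hb2 hν₂
  have hf1 := (su2_hasDerivAt_freeEnergyDensity_of_mem hb1 hν₁).differentiableAt
  have hf2 := (su2_hasDerivAt_freeEnergyDensity_of_mem hb2 hν₂).differentiableAt
  have key := mul_sub_le_deriv_sub_deriv (d := 4) (fundamentalRep (Fin 2)) hρ le_rfl (by norm_num) (b := β₂)
    (x := β₁) (y := β₂) ⟨by linarith, h12.le⟩ ⟨by linarith, le_rfl⟩ h12 hf1 hf2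
  rw [HaarSecondMoments.charVariance_su2, hd1, hd2] at key
  have e : (1 / 2 : ℝ) * Real.exp (-(8 * (4 - 1 : ℕ) * (2 : ℕ) * β₂)) * 1 = Real.exp (-(48 * β₂)) / 2 := by
    norm_num; ring_nf
  rw [e] at key
  linarith

/-- ★★ **Strict monotonicity of the mean plaquette along any DLR selection on the open window** (`SU(2)`, `d = 4`). [folklore] -/
theorem su2_plaquette_strictMonoOn {μ : ℝ → Measure (LGConfig 4 (Matrix.specialUnitaryGroup (Fin 2) ℂ))}
    (hμ : ∀ β ∈ Set.Ioo (0 : ℝ) (9 / 50), μ β ∈ ymGibbsMeasures (d := 4) (fundamentalRep (Fin 2)) β) :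
    StrictMonoOn (fun β => ∫ U, zdPlaquetteObs (fundamentalRep (Fin 2)) 0 0 1 U ∂(μ β)) (Set.Ioo (0 : ℝ) (9 / 50)) := by
  intro β₁ hβ₁ β₂ hβ₂ h12
  have h := su2_plaquette_increment_ge hβ₁.1 h12 hβ₂.2 (hμ β₁ hβ₁) (hμ β₂ hβ₂)
  have hpos : 0 < Real.exp (-(48 * β₂)) / 24 * (β₂ - β₁) := mul_pos (by positivity) (sub_pos.2 h12)
  simp only
  linarith

/-- ★ **The coupling is a Lipschitz function of the mean plaquette on the window** (`SU(2)`, `d = 4`): for `0 < β₁, β₂ < 9/50` and DLR states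
`ν_k ∈ 𝒢(β_k)`, `|β₂ − β₁| ≤ 24 e^{48·max(β₁,β₂)} · |u(ν₂) − u(ν₁)|` — the mean plaquette DETERMINES the coupling, quantitatively. [folklore] -/
theorem su2_abs_sub_le_of_plaquette {β₁ β₂ : ℝ} (hβ₁ : β₁ ∈ Set.Ioo (0 : ℝ) (9 / 50)) (hβ₂ : β₂ ∈ Set.Ioo (0 : ℝ) (9 / 50))
    {ν₁ ν₂ : Measure (LGConfig 4 (Matrix.specialUnitaryGroup (Fin 2) ℂ))}
    (hν₁ : ν₁ ∈ ymGibbsMeasures (d := 4) (fundamentalRep (Fin 2)) β₁)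
    (hν₂ : ν₂ ∈ ymGibbsMeasures (d := 4) (fundamentalRep (Fin 2)) β₂) :
    |β₂ - β₁| ≤ 24 * Real.exp (48 * max β₁ β₂) *
      |(∫ U, zdPlaquetteObs (fundamentalRep (Fin 2)) 0 0 1 U ∂ν₂) - ∫ U, zdPlaquetteObs (fundamentalRep (Fin 2)) 0 0 1 U ∂ν₁| := by
  set u₁ : ℝ := ∫ U, zdPlaquetteObs (fundamentalRep (Fin 2)) 0 0 1 U ∂ν₁ with hu₁
  set u₂ : ℝ := ∫ U, zdPlaquetteObs (fundamentalRep (Fin 2)) 0 0 1 U ∂ν₂ with hu₂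
  have hE : ∀ {b : ℝ}, b ≤ max β₁ β₂ → 1 ≤ Real.exp (48 * max β₁ β₂) * Real.exp (-(48 * b)) := fun {b} hb => by
    rw [← Real.exp_add]; exact Real.one_le_exp (by linarith)
  rcases lt_trichotomy β₁ β₂ with h | h | h
  · have key := su2_plaquette_increment_ge hβ₁.1 h hβ₂.2 hν₁ hν₂
    have hpos : 0 < u₂ - u₁ := lt_of_lt_of_le (mul_pos (by positivity) (sub_pos.2 h)) key
    rw [abs_of_pos (sub_pos.2 h), abs_of_pos hpos]
    have h1 := hE (le_max_right β₁ β₂)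
    have h2 : (β₂ - β₁) ≤ 24 * Real.exp (48 * max β₁ β₂) * (Real.exp (-(48 * β₂)) / 24 * (β₂ - β₁)) := by
      nlinarith [h1, sub_pos.2 h, Real.exp_pos (48 * max β₁ β₂), Real.exp_pos (-(48 * β₂))]
    calc β₂ - β₁ ≤ 24 * Real.exp (48 * max β₁ β₂) * (Real.exp (-(48 * β₂)) / 24 * (β₂ - β₁)) := h2
      _ ≤ 24 * Real.exp (48 * max β₁ β₂) * (u₂ - u₁) := mul_le_mul_of_nonneg_left key (by positivity)
  · subst h
    rw [sub_self, abs_zero]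
    positivity
  · have key := su2_plaquette_increment_ge hβ₂.1 h hβ₁.2 hν₂ hν₁
    have hpos : 0 < u₁ - u₂ := lt_of_lt_of_le (mul_pos (by positivity) (sub_pos.2 h)) key
    rw [abs_of_neg (sub_neg.2 h), abs_of_neg (sub_neg.2 (sub_pos.1 hpos)), neg_sub, neg_sub]
    have h1 := hE (le_max_left β₁ β₂)
    have h2 : (β₁ - β₂) ≤ 24 * Real.exp (48 * max β₁ β₂) * (Real.exp (-(48 * β₁)) / 24 * (β₁ - β₂)) := by
      nlinarith [h1, sub_pos.2 h, Real.exp_pos (48 * max β₁ β₂), Real.exp_pos (-(48 * β₁))]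
    calc β₁ - β₂ ≤ 24 * Real.exp (48 * max β₁ β₂) * (Real.exp (-(48 * β₁)) / 24 * (β₁ - β₂)) := h2
      _ ≤ 24 * Real.exp (48 * max β₁ β₂) * (u₁ - u₂) := mul_le_mul_of_nonneg_left key (by positivity)

end SU2

/-! ### Part C — every `SU(N)`, every `d ≥ 2`: strict monotonicity of the mean plaquette on the 't Hooft window -/

section SUN

variable {d N : ℕ}

/-- ★ **Every `SU(N)`, `N ≥ 2`, every `d ≥ 2`**: on ds-1's window `0 < b₁ < b₂ < N/(12(d−1))` (tree coupling), for DLR states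
`ν₁ ∈ 𝒢(b₁)`, `ν₂ ∈ 𝒢(b₂)`, the mean plaquette `u = ⟨(1/N) Re tr U_{(0;01)}⟩` satisfies
`#planes · N · (u(ν₂) − u(ν₁)) ≥ (1/2) e^{−8(d−1)N b₂} V₀ (b₂ − b₁)`, in particular it is STRICTLY increasing. [folklore] -/
theorem plaquette_increment_ge_dim_thooft (hd : 2 ≤ d) (hN : 2 ≤ N) {b₁ b₂ : ℝ} (h1 : 0 < b₁) (h12 : b₁ < b₂)
    (h2 : b₂ < (N : ℝ) / (12 * ((d : ℝ) - 1)))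
    {ν₁ ν₂ : Measure (LGConfig d (Matrix.specialUnitaryGroup (Fin N) ℂ))}
    (hν₁ : ν₁ ∈ ymGibbsMeasures (d := d) (fundamentalRep (Fin N)) b₁)
    (hν₂ : ν₂ ∈ ymGibbsMeasures (d := d) (fundamentalRep (Fin N)) b₂) :
    (1 / 2 : ℝ) * Real.exp (-(8 * (d - 1 : ℕ) * N * b₂)) * PlaquetteLowerBound.charVariance (fundamentalRep (Fin N)) *
        (b₂ - b₁) ≤
      (Fintype.card {q : Fin d × Fin d // q.1 < q.2} : ℝ) * N *
        ((∫ U, zdPlaquetteObs (fundamentalRep (Fin N)) 0 ⟨0, by omega⟩ ⟨1, by omega⟩ U ∂ν₂) -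
          ∫ U, zdPlaquetteObs (fundamentalRep (Fin N)) 0 ⟨0, by omega⟩ ⟨1, by omega⟩ U ∂ν₁) := by
  classical
  haveI : SecondCountableTopology (Matrix (Fin N) (Fin N) ℂ) := inferInstanceAs (SecondCountableTopology (Fin N → Fin N → ℂ))
  haveI : SecondCountableTopology (Matrix.specialUnitaryGroup (Fin N) ℂ) := Topology.IsEmbedding.subtypeVal.secondCountableTopology
  have hρ := TorusAreaLaw.isSpecialUnitaryModel_fundamentalRep N
  have hb1 : b₁ ∈ Set.Ioo (0 : ℝ) ((N : ℝ) / (12 * ((d : ℝ) - 1))) := ⟨h1, by linarith⟩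
  have hb2 : b₂ ∈ Set.Ioo (0 : ℝ) ((N : ℝ) / (12 * ((d : ℝ) - 1))) := ⟨by linarith, h2⟩
  have hd1 := deriv_freeEnergyDensity_eq_plaquette_dim_thooft hd hN hb1 hν₁
  have hd2 := deriv_freeEnergyDensity_eq_plaquette_dim_thooft hd hN hb2 hν₂
  -- differentiability at `b₁`, `b₂` through a DLR selection spliced with `ν₁`, `ν₂`
  obtain ⟨μ, hμ⟩ := CouplingResponse.exists_dlrSelection_dim (d := d) (N := N)
  have hsel1 : ∀ t ∈ Set.Icc (0 : ℝ) ((N : ℝ) / (12 * ((d : ℝ) - 1))),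
      (fun t => if t = b₁ then ν₁ else μ t) t ∈ ymGibbsMeasures (d := d) (fundamentalRep (Fin N)) t := by
    intro t _
    by_cases ht : t = b₁
    · simp only [ht, if_true]; exact hν₁
    · simp only [ht, if_false]; exact hμ t
  have hsel2 : ∀ t ∈ Set.Icc (0 : ℝ) ((N : ℝ) / (12 * ((d : ℝ) - 1))),
      (fun t => if t = b₂ then ν₂ else μ t) t ∈ ymGibbsMeasures (d := d) (fundamentalRep (Fin N)) t := by
    intro t _
    by_cases ht : t = b₂
    · simp only [ht, if_true]; exact hν₂
    · simp only [ht, if_false]; exact hμ t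
  have hf1 := (hasDerivAt_freeEnergyDensity_dim_thooft hd hN hsel1 hb1).differentiableAt
  have hf2 := (hasDerivAt_freeEnergyDensity_dim_thooft hd hN hsel2 hb2).differentiableAt
  have key := mul_sub_le_deriv_sub_deriv (d := d) (fundamentalRep (Fin N)) hρ hN hd (b := b₂)
    (x := b₁) (y := b₂) ⟨by linarith, h12.le⟩ ⟨by linarith, le_rfl⟩ h12 hf1 hf2
  rw [hd1, hd2] at key
  have e : -(Fintype.card {q : Fin d × Fin d // q.1 < q.2} : ℝ) * N *
        (1 - ∫ U, zdPlaquetteObs (fundamentalRep (Fin N)) 0 ⟨0, by omega⟩ ⟨1, by omega⟩ U ∂ν₂) -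
      -(Fintype.card {q : Fin d × Fin d // q.1 < q.2} : ℝ) * N *
        (1 - ∫ U, zdPlaquetteObs (fundamentalRep (Fin N)) 0 ⟨0, by omega⟩ ⟨1, by omega⟩ U ∂ν₁) =
      (Fintype.card {q : Fin d × Fin d // q.1 < q.2} : ℝ) * N *
        ((∫ U, zdPlaquetteObs (fundamentalRep (Fin N)) 0 ⟨0, by omega⟩ ⟨1, by omega⟩ U ∂ν₂) -
          ∫ U, zdPlaquetteObs (fundamentalRep (Fin N)) 0 ⟨0, by omega⟩ ⟨1, by omega⟩ U ∂ν₁) := by ring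
  rw [e] at key
  exact key

end SUN

end EnergyVariance

end Summit.Ventures.YMGap.RobustBall
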